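import Summits.QuantumFields.YangMills.Theorems.ScalingWindowSplitSelfNormalisedSkewnessStubTwoPointSmearing
import Summits.QuantumFields.YangMills.Theorems.ScalingWindowSplitSelfNormalisedSkewnessWitnessCumulants
import Summits.QuantumFields.YangMills.Theorems.ScalingWindowSplitSelfNormalisedSkewnessWitnessDefs
import Summits.QuantumFields.YangMills.Theorems.ScalingWindowSplitSelfNormalisedSkewnessWitnessFrame
import Summits.QuantumFields.YangMills.Theorems.SelfNormalisedSkewness.Negative.SelfNormalisedSkewnessFalseOfMaxwellDominatedWindowScheme
import HarnessLib

/-!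
# `SelfNormalisedSkewness` — negative side: the witness bump and the crux vocabulary at the witness

Route `ScalingWindowSplit`, crux `stmt-QuantumFields-18944`, line `Sketch` (negation branch), support for the
lead's `stub_witnessAssembly`.  (1) The past-supported bump `bumpU` of the `U(1)` witness: a `ContDiffBump`
around `−2e₀` of inner radius `bumpR = min δ₁ ¼` (`δ₁` the cone constant of `stub_twoPointSmearing`), read as a
Schwartz function; its support bookkeeping and that of its time shift `τ₋₁ bumpU`.  (2) The crux's `let`
vocabulary (`cruxT`, `cruxKappa3` of the disprover's negative lemma, whose hypothesis `H` this line inhabits)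
at the witness `(u1LatticeRep, swScheme 96)`, identified with central moments of the bare smeared fields.

References: Lüscher 1999 §3; standard.  No definitions of propositions, no named facts.
-/

noncomputable section

open scoped BigOperators ENNReal
open MeasureTheory Filter Topology
open Literature.MathematicalPhysics.QuantumLattice Literature.MathematicalPhysics.QuantumFieldTheory
open Literature.Probability.LatticeModels (box)

namespace Summit.QuantumFields.YangMills.Theorems.SelfNormalisedSkewness.Negative

/-! ### The bump -/

/-- The cone constant `δ₁` of `stub_twoPointSmearing` (lower two-point bound). [folklore] -/
def tpDelta : ℝ := Classical.choose stub_twoPointSmearing.2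

/-- Specification of `tpDelta`. [folklore] -/
theorem tpDelta_spec : 0 < tpDelta ∧ ∀ (u : SchwartzMap (EuclideanSpace ℝ (Fin 4)) ℝ) (t₀ r : ℝ), 0 < r →
    r ≤ tpDelta * t₀ → (∀ y, 0 ≤ u y) →
    (∀ y : EuclideanSpace ℝ (Fin 4), dist y (EuclideanSpace.single (0 : Fin 4) (-t₀)) ≤ r → 1 ≤ u y) →
    ∃ c a₀ : ℝ, 0 < c ∧ 0 < a₀ ∧ ∀ (a : ℝ), 0 < a → a ≤ a₀ → ∀ (L : ℕ), a ^ 2 * (L : ℝ) = 1 →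
    ∀ (H : Literature.Probability.LatticeModels.TorusSite 4 (2 * L + 1) → Fin 4 → Fin 4 → ℝ),
    (∀ z i j, H z i j = Literature.Probability.LatticeModels.torusGreen (z + Pi.single i 1) -
      Literature.Probability.LatticeModels.torusGreen (z + Pi.single i 1 - Pi.single j 1) -
      Literature.Probability.LatticeModels.torusGreen z +
      Literature.Probability.LatticeModels.torusGreen (z - Pi.single j 1)) →
    ∀ (πK : Literature.Probability.LatticeModels.TorusSite 4 (2 * L + 1) → {q : Fin 4 × Fin 4 // q.1 < q.2} →
      {q : Fin 4 × Fin 4 // q.1 < q.2} → ℝ),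
    (∀ n α α', πK n α α' = (1 / 2 : ℝ) * (-(H n α.1.1 α'.1.1) * (if α.1.2 = α'.1.2 then 1 else 0)
        + H n α.1.1 α'.1.2 * (if α.1.2 = α'.1.1 then 1 else 0)
        + H n α.1.2 α'.1.1 * (if α.1.1 = α'.1.2 then 1 else 0)
        - H n α.1.2 α'.1.2 * (if α.1.1 = α'.1.1 then 1 else 0))) →
    c ≤ ∑ x ∈ box 4 L, ∑ y ∈ (box 4 L).erase x, u (a • siteToE x) * thetaTest 4 u (a • siteToE y) *
      ∑ α, ∑ α', (πK (Literature.Probability.LatticeModels.Torus.proj (2 * L + 1) x -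
        Literature.Probability.LatticeModels.Torus.proj (2 * L + 1) y) α α') ^ 2 :=
  Classical.choose_spec stub_twoPointSmearing.2

/-- The inner radius of the bump: `min δ₁ ¼`. [folklore] -/
def bumpR : ℝ := min tpDelta (1 / 4)

/-- `0 < bumpR`. [folklore] -/
theorem bumpR_pos : 0 < bumpR := lt_min tpDelta_spec.1 (by norm_num)

/-- `bumpR ≤ ¼`. [folklore] -/
theorem bumpR_le_quarter : bumpR ≤ 1 / 4 := min_le_right _ _

/-- `bumpR ≤ δ₁`. [folklore] -/
theorem bumpR_le_tpDelta : bumpR ≤ tpDelta := min_le_left _ _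

/-- The centre `−2e₀` of the bump. [folklore] -/
def bumpCenter : E4 := EuclideanSpace.single (0 : Fin 4) (-2 : ℝ)

/-- Time coordinate of the centre. [folklore] -/
@[simp] theorem bumpCenter_apply_zero : bumpCenter 0 = -2 := by simp [bumpCenter]

/-- `‖bumpCenter‖ = 2`. [folklore] -/
theorem norm_bumpCenter : ‖bumpCenter‖ = 2 := by
  rw [bumpCenter, PiLp.norm_single]; norm_num

/-- The smooth bump around `−2e₀` (radii `bumpR`, `2 bumpR`). [folklore] -/
def bumpCDB : ContDiffBump bumpCenter := ⟨bumpR, 2 * bumpR, bumpR_pos, by linarith [bumpR_pos]⟩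

/-- **The witness bump `u`** as a Schwartz function. [folklore] -/
def bumpU : SchwartzMap E4 ℝ := bumpCDB.hasCompactSupport.toSchwartzMap bumpCDB.contDiff

/-- `bumpU` is the bump. [folklore] -/
theorem bumpU_apply (y : E4) : bumpU y = bumpCDB y := rfl

/-- `0 ≤ bumpU`. [folklore] -/
theorem bumpU_nonneg (y : E4) : 0 ≤ bumpU y := by rw [bumpU_apply]; exact bumpCDB.nonneg

/-- `bumpU = 1` (hence `≥ 1`) on the inner ball. [folklore] -/
theorem one_le_bumpU {y : E4} (hy : dist y (EuclideanSpace.single (0 : Fin 4) (-2 : ℝ)) ≤ bumpR) :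
    1 ≤ bumpU y := by
  rw [bumpU_apply, bumpCDB.one_of_mem_closedBall (by exact hy)]

/-- The support of `bumpU` is the outer closed ball. [folklore] -/
theorem tsupport_bumpU : tsupport bumpU = Metric.closedBall bumpCenter (2 * bumpR) := bumpCDB.tsupport_eq

/-- On the support of `bumpU` the time coordinate is `≤ −3/2`. [folklore] -/
theorem apply_zero_le_of_mem_tsupport_bumpU {y : E4} (hy : y ∈ tsupport bumpU) : y 0 ≤ -3 / 2 := by
  rw [tsupport_bumpU, Metric.mem_closedBall, dist_eq_norm] at hy
  -- the time coordinate is bounded by the Euclidean norm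
  have hcoord : ∀ z : E4, |z 0| ≤ ‖z‖ := fun z => by
    rw [EuclideanSpace.norm_eq z]
    refine Real.abs_le_sqrt ?_
    calc z 0 ^ 2 = ‖z 0‖ ^ 2 := by rw [Real.norm_eq_abs, sq_abs]
      _ ≤ ∑ j, ‖z j‖ ^ 2 :=
          Finset.single_le_sum (f := fun j => ‖z j‖ ^ 2) (fun j _ => sq_nonneg _) (Finset.mem_univ 0)
  have h := (hcoord (y - bumpCenter)).trans hy
  rw [PiLp.sub_apply, bumpCenter_apply_zero] at h
  have := (abs_le.1 h).2
  linarith [bumpR_le_quarter]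

/-- On the support of `bumpU` the norm is `≤ 3`. [folklore] -/
theorem norm_le_of_mem_tsupport_bumpU {y : E4} (hy : y ∈ tsupport bumpU) : ‖y‖ ≤ 3 := by
  rw [tsupport_bumpU, Metric.mem_closedBall, dist_eq_norm] at hy
  have := norm_le_norm_add_norm_sub' y bumpCenter
  linarith [bumpR_le_quarter, norm_bumpCenter]

/-- `tsupport bumpU ⊆ {y₀ < 0}`. [folklore] -/
theorem tsupport_bumpU_subset_neg : tsupport bumpU ⊆ {y : E4 | y 0 < 0} := fun y hy => by
  have := apply_zero_le_of_mem_tsupport_bumpU hy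
  simp only [Set.mem_setOf_eq]; linarith

/-- `tsupport bumpU ⊆ {y₀ ≤ −1}`. [folklore] -/
theorem tsupport_bumpU_subset_le : tsupport bumpU ⊆ {y : E4 | y 0 ≤ -1} := fun y hy => by
  have := apply_zero_le_of_mem_tsupport_bumpU hy
  simp only [Set.mem_setOf_eq]; linarith

/-- `tsupport bumpU ⊆ closedBall 0 3`. [folklore] -/
theorem tsupport_bumpU_subset_ball : tsupport bumpU ⊆ Metric.closedBall (0 : E4) 3 := fun y hy => by
  rw [Metric.mem_closedBall, dist_zero_right]; exact norm_le_of_mem_tsupport_bumpU hy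

/-- Support of a time-shifted test. [folklore] -/
theorem tsupport_timeShiftTest_subset (u : SchwartzMap E4 ℝ) (t : ℝ) :
    tsupport (timeShiftTest 4 t u) ⊆ (fun y : E4 => y - EuclideanSpace.single 0 t) ⁻¹' tsupport u := by
  refine closure_minimal ?_ ((isClosed_tsupport _).preimage (by fun_prop))
  intro y hy
  rw [Function.mem_support, timeShiftTest_apply] at hy
  exact subset_tsupport _ (Function.mem_support.2 hy)

/-- `0 ≤ τ₋₁ bumpU`. [folklore] -/
theorem shiftU_nonneg (y : E4) : 0 ≤ timeShiftTest 4 (-1) bumpU y := by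
  rw [timeShiftTest_apply]; exact bumpU_nonneg _

/-- `τ₋₁ bumpU ≥ 1` on the inner ball around `−3e₀`. [folklore] -/
theorem one_le_shiftU {y : E4} (hy : dist y (EuclideanSpace.single (0 : Fin 4) (-3 : ℝ)) ≤ bumpR) :
    1 ≤ timeShiftTest 4 (-1) bumpU y := by
  rw [timeShiftTest_apply]
  refine one_le_bumpU ?_
  rw [dist_eq_norm] at hy ⊢
  have e : y - EuclideanSpace.single (0 : Fin 4) (-1 : ℝ) - EuclideanSpace.single (0 : Fin 4) (-2 : ℝ) =
      y - EuclideanSpace.single (0 : Fin 4) (-3 : ℝ) := by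
    ext i
    simp only [PiLp.sub_apply, PiLp.single_apply]
    split_ifs <;> ring
  rw [e]; exact hy

/-- `tsupport (τ₋₁ bumpU) ⊆ {y₀ < 0}`. [folklore] -/
theorem tsupport_shiftU_subset_neg : tsupport (timeShiftTest 4 (-1) bumpU) ⊆ {y : E4 | y 0 < 0} := fun y hy => by
  have h := apply_zero_le_of_mem_tsupport_bumpU (tsupport_timeShiftTest_subset bumpU (-1) hy)
  simp only [PiLp.sub_apply, PiLp.single_apply, if_true] at h
  simp only [Set.mem_setOf_eq]; linarith

/-! ### The crux vocabulary at the witness -/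

/-- The bare smeared `U(1)` curvature field at step `k` of `swScheme 96` (spacing `1/(k+1)`, box half-side
`(k+1)²`, torus side `2(k+1)²+1`). [folklore] -/
def PhiW (k : ℕ) (w : SchwartzMap E4 ℝ) (U : GaugeConfig 4 (2 * (k + 1) ^ 2 + 1) Circle) : ℝ :=
  smearedLatticeField (actionDensity u1Rep) (box 4 ((k + 1) ^ 2)) (((k : ℝ) + 1)⁻¹) 1 0 w
    (torusLift (2 * (k + 1) ^ 2 + 1) U)

/-- `PhiW` is measurable. [folklore] -/
theorem measurable_PhiW (k : ℕ) (w : SchwartzMap E4 ℝ) : Measurable (PhiW k w) :=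
  witness_measurable_smeared u1LatticeRep.curvature.measurable _ _ _ _ w _

/-- `PhiW` is bounded. [folklore] -/
theorem exists_abs_PhiW_le (k : ℕ) (w : SchwartzMap E4 ℝ) : ∃ C : ℝ, ∀ U, |PhiW k w U| ≤ C := by
  obtain ⟨C, hC⟩ := u1LatticeRep.curvature.bounded
  exact ⟨_, fun U => witness_abs_smeared_le hC _ _ _ _ w _⟩

/-- **`T_k(w)` of the crux at the witness is the covariance of the bare smeared fields at `w`, `θw`.**
[folklore] -/
theorem cruxT_witness_eq (w : SchwartzMap E4 ℝ) (k : ℕ) :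
    cruxT u1LatticeRep (swScheme 96) w k =
      ∫ U, (PhiW k w U - ∫ U', PhiW k w U' ∂(wilsonMeasure u1Rep (((k : ℝ) + 1) ^ 96) :
            Measure (GaugeConfig 4 (2 * (k + 1) ^ 2 + 1) Circle))) *
          (PhiW k (thetaTest 4 w) U - ∫ U', PhiW k (thetaTest 4 w) U'
            ∂(wilsonMeasure u1Rep (((k : ℝ) + 1) ^ 96) : Measure (GaugeConfig 4 (2 * (k + 1) ^ 2 + 1) Circle)))
        ∂(wilsonMeasure u1Rep (((k : ℝ) + 1) ^ 96) : Measure (GaugeConfig 4 (2 * (k + 1) ^ 2 + 1) Circle)) := by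
  set μ : Measure (GaugeConfig 4 (2 * (k + 1) ^ 2 + 1) Circle) := wilsonMeasure u1Rep (((k : ℝ) + 1) ^ 96) with hμ
  haveI : IsProbabilityMeasure μ :=
    isProbabilityMeasure_wilsonMeasure (L := 2 * (k + 1) ^ 2 + 1) u1Rep continuous_u1Rep _
  have hLS2 : latticeSchwinger u1LatticeRep.ρ (cruxBare (swScheme 96)) (fun s => s.F) k (1 + 1)
      (fun _ => u1LatticeRep.curvature) ![w, thetaTest 4 w] = ∫ U, PhiW k w U * PhiW k (thetaTest 4 w) U ∂μ := by
    simp only [latticeSchwinger, Fin.prod_univ_succ, Fin.prod_univ_zero, Matrix.cons_val_zero, Matrix.cons_val_succ,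
      mul_one]
    rfl
  have hLS1 : ∀ v : SchwartzMap E4 ℝ, latticeSchwinger u1LatticeRep.ρ (cruxBare (swScheme 96)) (fun s => s.F) k 1
      (fun _ => u1LatticeRep.curvature) ![v] = ∫ U, PhiW k v U ∂μ := fun v => by
    simp only [latticeSchwinger, Fin.prod_univ_one, Matrix.cons_val_fin_one]
    rfl
  unfold cruxT
  rw [hLS2, hLS1, hLS1]
  obtain ⟨C1, hC1⟩ := exists_abs_PhiW_le k w
  obtain ⟨C2, hC2⟩ := exists_abs_PhiW_le k (thetaTest 4 w)
  have i1 : Integrable (PhiW k w) μ := integrable_of_abs_le_const (measurable_PhiW k w) hC1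
  have i2 : Integrable (PhiW k (thetaTest 4 w)) μ := integrable_of_abs_le_const (measurable_PhiW k _) hC2
  have i12 : Integrable (fun U => PhiW k w U * PhiW k (thetaTest 4 w) U) μ :=
    integrable_of_abs_le_const ((measurable_PhiW k w).mul (measurable_PhiW k _)) (C := |C1| * |C2|) fun U => by
      rw [abs_mul]
      exact mul_le_mul ((hC1 U).trans (le_abs_self _)) ((hC2 U).trans (le_abs_self _)) (abs_nonneg _)
        (abs_nonneg _)
  have h := cm2_eq_poly i1 i2 i12
  rw [cm2] at h
  rw [← h]

/-- **`κ₃^canon_k(f,g,h)` of the crux at the witness is `(√T_k(u))⁻³` times the third central moment of the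
bare smeared fields.** [folklore] -/
theorem cruxKappa3_witness_eq (u f g h : SchwartzMap E4 ℝ) (k : ℕ) :
    cruxKappa3 u1LatticeRep (swScheme 96) u f g h k =
      (Real.sqrt (cruxT u1LatticeRep (swScheme 96) u k))⁻¹ ^ 3 *
        ∫ U, (PhiW k f U - ∫ U', PhiW k f U' ∂(wilsonMeasure u1Rep (((k : ℝ) + 1) ^ 96) :
              Measure (GaugeConfig 4 (2 * (k + 1) ^ 2 + 1) Circle))) *
            (PhiW k g U - ∫ U', PhiW k g U' ∂(wilsonMeasure u1Rep (((k : ℝ) + 1) ^ 96) :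
              Measure (GaugeConfig 4 (2 * (k + 1) ^ 2 + 1) Circle))) *
            (PhiW k h U - ∫ U', PhiW k h U' ∂(wilsonMeasure u1Rep (((k : ℝ) + 1) ^ 96) :
              Measure (GaugeConfig 4 (2 * (k + 1) ^ 2 + 1) Circle)))
          ∂(wilsonMeasure u1Rep (((k : ℝ) + 1) ^ 96) : Measure (GaugeConfig 4 (2 * (k + 1) ^ 2 + 1) Circle)) := by
  unfold cruxKappa3
  rw [kappa3_eq_cube_mul_integral_centered u1LatticeRep (cruxCanon u1LatticeRep (swScheme 96) u) k f g h]
  rfl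

end Summit.QuantumFields.YangMills.Theorems.SelfNormalisedSkewness.Negative

end
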